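import Literature.AlgebraicGeometry.Villamayor2007.DegreePreserving
import Mathlib.Algebra.Polynomial.Splits
import HarnessLib

/-!
# Villamayor 2007, Lemma 1.3 and Thm. 1.16 (i): the purely ramified locus is CUT OUT by the elimination ideals —
# the direction «`P ⊇ H_{F_b}`-ideals ⟹ `f` has a unique root at `P`», PROVED

O. E. Villamayor U., *Hypersurface singularities in positive characteristic*, Adv. Math. **213** (2007)
687–733 = arXiv:math/0606796 [Villamayor2007]; locators «p00NN Lnn» = chunk · line of the held arXiv text
(`lit read paper:arxiv-math_0606796`, chunks p0006, p0008–p0010 re-read before typing). Sequel of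
`DegreePreserving.lean` (which proves the other direction, `elimIdeal_le_ker_of_map_eq_pow`: purely ramified
⟹ all `I_r`, `r ≥ 1`, die) and of `CharPolyGenerators.lean` (the generators `coeff_n ψ_{F_b^{(e)}(Y₁)}` of
`H_{F_b}`, `eval_charPolyOf_self`). Campaign `res-hironaka` (D-0089), ladder rung LIT-6. PROOF file: theorems only,
no definitions, no named facts; nothing of Hironaka's 2017 manuscript is referred to.

## What is proved

* **Def. 1.1 p0006 L36–L43.** «the morphism is purely ramified at `P` if and only if the class of `f(Z)` in
  `k̄(P)[Z]` has a unique root» — used as the target shape `f̄ = (Z − α)^b`.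
* **Lemma 1.3 p0006 L70–L78, direction 2) ⟹ 1) in the split case.** «Fix `f(Z) ∈ K[Z]`, monic of degree `b` …
  1) `f(Z) = (Z − α)^b` for some `α ∈ K`. 2) The class of `Δ^k(f(Z))` in `K[Z]/⟨f(Z)⟩` is nilpotent for all
  `0 ≤ k < b`.» PROVED in the form actually used: if `f` is monic of degree `b`, `f(α) = 0` and the Taylor
  coefficients `Δ^e f(α)`, `1 ≤ e < b`, vanish, then `f = (Z − α)^b` (`eq_X_sub_C_pow_of_taylor_coeff_eq_zero`;
  the printed proof reads `Tay(f)` at one root — here `Tay(f)(α) = T^b` directly).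
* **Thm. 1.16 (i) p0009 L55–L64, L80–L101, direction «`V(⟨G_{b,i}(a)⟩) ⊆` purely ramified locus».** «If `P`
  contains the ideal `⟨G_{b,1},…,G_{b,r_b}⟩` in `R_b`, then any `Q_i` contains `⟨F_b^{(1)}(Y₁),…,F_b^{(b−1)}(Y₁)⟩`
  … so Lemma 1.3 asserts that the fiber over `P` is purely ramified.» PROVED with the `H_{F_b}`-generators of
  Def. 1.21 in the role of the `G_{b,i}` (the printed step through 1.11 «`√⟨G_{b,i}⟩ = √⟨F_b^{(e)}(Y₁)⟩`» is replaced
  by the explicit integral equations `ψ_{F_b^{(e)}}(F_b^{(e)}(Y_j)) = 0` of Lemma 1.19, whose lower coefficients ARE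
  the `H`-generators — so the hypothesis here is «`P ⊇ ℋ`-ideals», weaker than «`P ⊇ I_r`» since `ℋ_f ⊆ R̄_f`):
  - `aeval_univMonicDeltaAt_eq_zero`: at a root vector `α` of `f = ∏ (Z − α_i)` (reduced coefficient ring) where all
    `H`-generators vanish, every `F_b^{(e)}(Y_j)`, `1 ≤ e ≤ b − 1`, vanishes, i.e. `Δ^e f(α_j) = 0`;
  - `eq_X_sub_C_pow_of_hElimIdeal_eq_bot`: hence `f = (Z − α_j)^b` for every `j` (split + reduced case);
  - `exists_map_eq_X_sub_C_pow_of_hElimIdeal_le_ker` (**Thm. 1.16 (i) ⟹**): for a `k`-algebra map `φ : S → K`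
    to a domain over which `f = monicOf a` splits (e.g. `K = k̄(P)`), if `φ` kills every `I^{(2)}_r(f)`, `r ≥ 1`
    (a fortiori if it kills every `I_r(f)`: `exists_map_eq_X_sub_C_pow_of_elimIdeal_le_ker`), then
    `φ(f) = (Z − α)^b` for some `α ∈ K`.
  Together with `DegreePreserving.elimIdeal_le_ker_of_map_eq_pow` this is Thm. 1.16 (i) at every point with values
  in a domain where `f` splits: `φ(f)` is a pure `b`-th power ⟺ `I_r ⊆ ker φ` for all `r ≥ 1`
  (`map_eq_X_sub_C_pow_iff_elimIdeal_le_ker`).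

## References

* O. E. Villamayor U., Adv. Math. 213 (2007) 687–733 = arXiv:math/0606796: Def. 1.1, Lemma 1.3, 1.11, Lemma 1.19,
  Def. 1.21, Thm. 1.16. [Villamayor2007]
-/

noncomputable section

open scoped Polynomial

namespace Literature.AlgebraicGeometry.Villamayor2007

open MvPolynomial

universe u v w

/-! ## Lemma 1.3, 2) ⟹ 1): vanishing Taylor coefficients at a root force `f = (Z − α)^b` -/

section Lemma13

variable {K : Type w} [CommRing K] {b : ℕ}

/-- **Lemma 1.3, direction 2) ⟹ 1), split/one-root form** [Villamayor 2007, Lemma 1.3 p0006 L70–L78 «1) `f(Z) =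
(Z − α)^b` … 2) The class of `Δ^k(f(Z))` … is nilpotent for all integer `0 ≤ k < b`»; proof p0006 L80–L95 via
`Tay(f(Z)) = Σ Δ^r(f(Z))T^r`]: if `f` is monic of degree `b`, `α` is a root, and the Taylor coefficients
`Δ^e(f)(α) = coeff_e f(Z + α)` vanish for `1 ≤ e < b`, then `f(Z + α) = Z^b`, i.e. `f = (Z − α)^b`.
[cite: Villamayor2007, Lemma 1.3 p0006 L70–L95] -/
theorem eq_X_sub_C_pow_of_taylor_coeff_eq_zero {f : K[X]} (hmonic : f.Monic) (hdeg : f.natDegree = b) (α : K)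
    (hroot : f.eval α = 0) (hcoeff : ∀ e : ℕ, 1 ≤ e → e < b → (Polynomial.taylor α f).coeff e = 0) :
    f = (Polynomial.X - Polynomial.C α) ^ b := by
  rcases subsingleton_or_nontrivial K with hK | hK
  · exact Subsingleton.elim _ _
  have htay : Polynomial.taylor α f = Polynomial.X ^ b := by
    ext e
    rw [Polynomial.coeff_X_pow]
    rcases Nat.lt_or_ge e b with he | he
    · rw [if_neg (Nat.ne_of_lt he)]
      rcases Nat.eq_zero_or_pos e with h0 | h0
      · subst h0
        rw [Polynomial.taylor_coeff_zero, hroot]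
      · exact hcoeff e h0 he
    · rcases Nat.eq_or_lt_of_le he with h1 | h1
      · subst h1
        rw [if_pos rfl]
        have h := Polynomial.leadingCoeff_taylor α f
        rw [Polynomial.leadingCoeff, Polynomial.natDegree_taylor, hdeg, hmonic.leadingCoeff] at h
        exact h
      · rw [if_neg (Nat.ne_of_gt h1)]
        exact Polynomial.coeff_eq_zero_of_natDegree_lt (by rw [Polynomial.natDegree_taylor, hdeg]; exact h1)
  calc f = Polynomial.taylor (-α) (Polynomial.taylor α f) := by
        rw [Polynomial.taylor_taylor, neg_add_cancel, Polynomial.taylor_zero]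
    _ = (Polynomial.X - Polynomial.C α) ^ b := by
        rw [htay, Polynomial.taylor_X_pow, Polynomial.C_neg, ← sub_eq_add_neg]

end Lemma13

/-! ## The split point: specialization at the coefficients of `∏ (Z − α_i)` is evaluation at the roots -/

section SplitPoint

variable (k : Type v) [CommRing k] {K : Type w} [CommRing K] [Algebra k K] {b : ℕ}

/-- `∏ (Z − α_i)` is the image of the universal `F_b` under `Y_i ↦ α_i`. [cite: Villamayor2007, §1.5 p0007 L15–L16] -/
theorem prod_X_sub_C_eq_map_univMonic (α : Fin b → K) :
    (∏ i : Fin b, (Polynomial.X - Polynomial.C (α i))) =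
      (univMonic (Fin b) K).map ((aeval α : MvPolynomial (Fin b) K →ₐ[K] K) : MvPolynomial (Fin b) K →+* K) := by
  rw [univMonic, Polynomial.map_prod]
  refine Finset.prod_congr rfl fun i _ => ?_
  simp

/-- **At a split point, specializing is evaluating at the roots**: for `f = ∏ (Z − α_i)` and `G ∈ R_b`,
`G(coefficients of f) = G(α₁,…,α_b)` («`F_b(Z)` defines `f(Z)`», p0007 L63–L64, through `Y_i ↦ α_i`).
[cite: Villamayor2007, §1.5 p0007 L63–L66] -/
theorem specialize_coeffVec_prod_X_sub_C (α : Fin b → K) (G : symmetricSubalgebra (Fin b) k) :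
    specialize k (coeffVec b (∏ i : Fin b, (Polynomial.X - Polynomial.C (α i)))) G =
      aeval α (G : MvPolynomial (Fin b) k) := by
  let θ : MvPolynomial (Fin b) K →ₐ[K] K := aeval α
  have hθ : (⇑θ : MvPolynomial (Fin b) K → K) = ⇑(θ.restrictScalars k) := rfl
  have hval : (fun i : Fin b => (θ.restrictScalars k) (X i : MvPolynomial (Fin b) K)) = α := by
    funext i
    rw [AlgHom.restrictScalars_apply, aeval_X]
  rw [prod_X_sub_C_eq_map_univMonic, coeffVec_map θ, hθ, specialize_comp, AlgHom.comp_apply,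
    specialize_coeffVec_univMonic, comp_aeval_apply, hval]

/-- The universal `F_b` over `k` maps to `∏ (Z − α_i)` under `Y_i ↦ α_i`. [cite: Villamayor2007, §1.5 p0007 L15–L16] -/
theorem map_univMonic_aeval (α : Fin b → K) :
    (univMonic (Fin b) k).map ((aeval α : MvPolynomial (Fin b) k →ₐ[k] K) : MvPolynomial (Fin b) k →+* K) =
      ∏ i : Fin b, (Polynomial.X - Polynomial.C (α i)) := by
  rw [univMonic, Polynomial.map_prod]
  refine Finset.prod_congr rfl fun i _ => ?_
  simp

/-- The operators `Δ^e` commute with ring maps («compatible with change of the base ring», Def. 1.2 p0006 L67–L68).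
[cite: Villamayor2007, Def. 1.2 p0006 L67–L68] -/
theorem hasseDeriv_map {A : Type u} [CommRing A] {B : Type v} [CommRing B] (φ : A →+* B) (e : ℕ) (p : A[X]) :
    (Polynomial.hasseDeriv e p).map φ = Polynomial.hasseDeriv e (p.map φ) := by
  ext n
  simp [Polynomial.coeff_map, Polynomial.hasseDeriv_coeff]

/-- `F_b^{(e)}(Y_j)` evaluated at the roots `α` is the `e`-th Taylor coefficient `Δ^e f(α_j) = coeff_e f(Z + α_j)` of
`f = ∏ (Z − α_i)` (1.7 / Def. 1.2 «`Tay(F(Z)) = Σ Δ^r(F(Z))T^r`», through `Y_i ↦ α_i`).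
[cite: Villamayor2007, 1.7 p0008 L1–L12] -/
theorem aeval_univMonicDeltaAt (α : Fin b → K) (e : ℕ) (j : Fin b) :
    aeval α (univMonicDeltaAt (Fin b) k e j) =
      (Polynomial.taylor (α j) (∏ i : Fin b, (Polynomial.X - Polynomial.C (α i)))).coeff e := by
  have h := Polynomial.eval₂_hom ((aeval α : MvPolynomial (Fin b) k →ₐ[k] K) : MvPolynomial (Fin b) k →+* K)
    (X j) (p := Polynomial.hasseDeriv e (univMonic (Fin b) k))
  rw [RingHom.coe_coe, aeval_X] at h
  change aeval α ((Polynomial.hasseDeriv e (univMonic (Fin b) k)).eval (X j)) = _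
  rw [← h, ← Polynomial.eval_map, hasseDeriv_map, map_univMonic_aeval, Polynomial.taylor_coeff]

/-- **The `H_{F_b}`-relations kill the `F_b^{(e)}(Y_j)`** [Villamayor 2007, Thm. 1.16 (i) proof p0009 L80–L96 «If
`P` contains the ideal … then any `Q_i` contains `⟨F_b^{(1)}(Y₁),…,F_b^{(b−1)}(Y₁)⟩`», here through the explicit
integral equations of Lemma 1.19 «`ψ_Θ(Θ) = 0`» instead of 1.11]: at a root vector `α` (reduced coefficient ring)
where every generator `coeff_n ψ_{F_b^{(e)}}`, `1 ≤ e ≤ b − 1`, `n < b`, of `H_{F_b}` vanishes, `F_b^{(e)}(Y_j)(α) = 0`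
for all such `e` and all `j` — indeed `ψ` becomes `V^b`, so `F_b^{(e)}(Y_j)(α)^b = 0`.
[cite: Villamayor2007, Thm. 1.16 (i) p0009 L80–L96] -/
theorem aeval_univMonicDeltaAt_eq_zero [IsReduced K] (α : Fin b → K)
    (hH : ∀ e n : ℕ, 1 ≤ e → e + 1 ≤ b → n < b →
      aeval α ((charPolyOf (Fin b) k (univMonicDelta (Fin b) k e)).coeff n) = 0)
    {e : ℕ} (he1 : 1 ≤ e) (he : e + 1 ≤ b) (j : Fin b) :
    aeval α (univMonicDeltaAt (Fin b) k e j) = 0 := by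
  rcases subsingleton_or_nontrivial k with hk | hk
  · have : Subsingleton K := by
      refine subsingleton_of_zero_eq_one ?_
      rw [← (algebraMap k K).map_one, Subsingleton.elim (1 : k) 0, map_zero]
    exact Subsingleton.elim _ _
  set ψ := charPolyOf (Fin b) k (univMonicDelta (Fin b) k e) with hψ
  have hdegψ : ψ.natDegree = b := by rw [hψ, natDegree_charPolyOf, Fintype.card_fin]
  have hcoeffb : ψ.coeff b = 1 := by
    have h := (charPolyOf_monic (univMonicDelta (Fin b) k e)).coeff_natDegree
    rwa [← hψ, hdegψ] at h
  -- Lemma 1.19: `ψ(F_b^{(e)}(Y_j)) = 0`, pushed along `Y ↦ α`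
  have hroot : ψ.eval (univMonicDeltaAt (Fin b) k e j) = 0 := eval_charPolyOf_self _ j
  have h1 : Polynomial.eval₂ ((aeval α : MvPolynomial (Fin b) k →ₐ[k] K) : MvPolynomial (Fin b) k →+* K)
      (aeval α (univMonicDeltaAt (Fin b) k e j)) ψ = 0 := by
    have h := Polynomial.eval₂_hom ((aeval α : MvPolynomial (Fin b) k →ₐ[k] K) : MvPolynomial (Fin b) k →+* K)
      (univMonicDeltaAt (Fin b) k e j) (p := ψ)
    rw [RingHom.coe_coe] at h
    rw [h, hroot, map_zero]
  -- `ψ` becomes `V^b`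
  have h2 : ∀ y : K, Polynomial.eval₂ ((aeval α : MvPolynomial (Fin b) k →ₐ[k] K) : MvPolynomial (Fin b) k →+* K)
      y ψ = y ^ b := by
    intro y
    rw [← Polynomial.eval_map, Polynomial.eval_eq_sum_range' (n := b + 1)
      (lt_of_le_of_lt Polynomial.natDegree_map_le (by rw [hdegψ]; exact Nat.lt_succ_self b)),
      Finset.sum_range_succ, Finset.sum_eq_zero, zero_add, Polynomial.coeff_map, hcoeffb, map_one, one_mul]
    intro i hi
    rw [Polynomial.coeff_map, RingHom.coe_coe, hH e i he1 he (Finset.mem_range.mp hi), zero_mul]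
  rw [h2] at h1
  exact IsReduced.eq_zero _ ⟨b, h1⟩

variable {k}

/-- `ℋ` is functorial in the base ring: `I^{(2)}_r(φ ∘ a) = φ(I^{(2)}_r(a)) S'` (as `elimIdeal_map`; Def. 1.2 / 1.7
«compatible with change of base rings»). [cite: Villamayor2007, 1.7 p0008 L10–L12] -/
theorem hElimIdeal_map {S : Type u} [CommRing S] [Algebra k S] {S' : Type w} [CommRing S'] [Algebra k S']
    (φ : S →ₐ[k] S') (a : Fin b → S) (r : ℕ) :
    hElimIdeal k (⇑φ ∘ a) r = (hElimIdeal k a r).map φ := by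
  rw [hElimIdeal, hElimIdeal, Ideal.map_span]
  congr 1
  ext x
  simp only [hElimGen, Set.mem_setOf_eq, Set.mem_image, specialize_comp, AlgHom.comp_apply]
  constructor
  · rintro ⟨H, hH, hhom, rfl⟩
    exact ⟨_, ⟨H, hH, hhom, rfl⟩, rfl⟩
  · rintro ⟨_, ⟨H, hH, hhom, rfl⟩, rfl⟩
    exact ⟨H, hH, hhom, rfl⟩

variable (k)

/-- **All roots coincide where `ℋ` dies (split, reduced case)** [Villamayor 2007, Thm. 1.16 (i) p0009 L55–L64 with
Lemma 1.3]: if `f = monicOf a = ∏ (Z − α_i)` over a reduced `k`-algebra `K` and every ideal `I^{(2)}_r(f)`, `r ≥ 1`,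
of `ℋ_f` is zero, then `f = (Z − α_j)^b` for every `j` — «the class of `f(Z)` … has a unique root» (Def. 1.1).
[cite: Villamayor2007, Thm. 1.16 (i) p0009 L55–L64] -/
theorem eq_X_sub_C_pow_of_hElimIdeal_eq_bot [IsReduced K] (a : Fin b → K) (α : Fin b → K)
    (hsplit : monicOf a = ∏ i : Fin b, (Polynomial.X - Polynomial.C (α i)))
    (hH : ∀ r : ℕ, 1 ≤ r → hElimIdeal k a r = ⊥) (j : Fin b) :
    monicOf a = (Polynomial.X - Polynomial.C (α j)) ^ b := by
  rcases subsingleton_or_nontrivial K with hK | hK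
  · exact Subsingleton.elim _ _
  have ha : a = coeffVec b (∏ i : Fin b, (Polynomial.X - Polynomial.C (α i))) := by
    rw [← hsplit, coeffVec_monicOf]
  -- the `H`-generators vanish at `α`
  have hgen : ∀ e n : ℕ, 1 ≤ e → e + 1 ≤ b → n < b →
      aeval α ((charPolyOf (Fin b) k (univMonicDelta (Fin b) k e)).coeff n) = 0 := by
    intro e n he1 he hn
    have hmem : (charPolyOf (Fin b) k (univMonicDelta (Fin b) k e)).coeff n ∈ hSubalgebra (Fin b) k :=
      coeff_charPolyOf_mem_hSubalgebra he1 (by rw [Fintype.card_fin]; exact he) n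
    have hhom := isHomogeneous_coeff_charPolyOf_univMonicDelta (k := k) (ι := Fin b) (e := e) (n := n)
      (by rw [Fintype.card_fin]; omega) (by rw [Fintype.card_fin]; omega)
    have hr : 1 ≤ (Fintype.card (Fin b) - n) * (Fintype.card (Fin b) - e) := by
      rw [Fintype.card_fin]
      exact Nat.one_le_iff_ne_zero.mpr (Nat.mul_ne_zero (by omega) (by omega))
    have hx : specialize k a ⟨_, hSubalgebra_le_symmetricSubalgebra hmem⟩ ∈ hElimIdeal k a _ :=
      Ideal.subset_span ⟨_, hmem, hhom, rfl⟩
    rw [hH _ hr, Ideal.mem_bot, ha, specialize_coeffVec_prod_X_sub_C] at hx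
    exact hx
  -- hence the Taylor coefficients `Δ^e f(α_j)`, `1 ≤ e < b`, vanish (Lemma 1.19 + reducedness)
  have hcoeff : ∀ e : ℕ, 1 ≤ e → e < b →
      (Polynomial.taylor (α j) (∏ i : Fin b, (Polynomial.X - Polynomial.C (α i)))).coeff e = 0 := by
    intro e he1 he
    rw [← aeval_univMonicDeltaAt k α e j]
    exact aeval_univMonicDeltaAt_eq_zero k α hgen he1 (by omega) j
  -- Lemma 1.3
  rw [hsplit]
  refine eq_X_sub_C_pow_of_taylor_coeff_eq_zero
    (Polynomial.monic_prod_of_monic _ _ fun i _ => Polynomial.monic_X_sub_C (α i)) ?_ (α j) ?_ hcoeff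
  · rw [Polynomial.natDegree_prod_of_monic _ _ fun i _ => Polynomial.monic_X_sub_C (α i)]
    simp
  · rw [Polynomial.eval_prod]
    exact Finset.prod_eq_zero (Finset.mem_univ j) (by simp)

/-- The same with the hypothesis on the FULL elimination ideals `I_r` (`ℋ_f ⊆ R̄_f`).
[cite: Villamayor2007, Thm. 1.16 (i) p0009 L55–L64] -/
theorem eq_X_sub_C_pow_of_elimIdeal_eq_bot [IsReduced K] (a : Fin b → K) (α : Fin b → K)
    (hsplit : monicOf a = ∏ i : Fin b, (Polynomial.X - Polynomial.C (α i)))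
    (hI : ∀ r : ℕ, 1 ≤ r → elimIdeal k a r = ⊥) (j : Fin b) :
    monicOf a = (Polynomial.X - Polynomial.C (α j)) ^ b :=
  eq_X_sub_C_pow_of_hElimIdeal_eq_bot k a α hsplit
    (fun r hr => le_bot_iff.mp ((hElimIdeal_le_elimIdeal a r).trans (hI r hr).le)) j

end SplitPoint

/-! ## Thm. 1.16 (i): at a point `φ : S → K` (a domain where `f` splits), `φ(f)` is a pure power iff `I_r ⊆ ker φ` -/

section Point

-- `S` and `K` live in one universe, as in `elimIdeal_map` / `elimIdeal_le_ker_of_map_eq_pow`.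
variable (k : Type v) [CommRing k] {S : Type w} [CommRing S] [Algebra k S] {K : Type w} [CommRing K]
  [Algebra k K] {b : ℕ}

/-- A monic split polynomial of degree `b` over a domain is `∏_{i < b} (Z − α_i)` for a root VECTOR `α : Fin b → K`
(enumeration of the multiset of roots). [cite: Villamayor2007, §1.1 p0006 L36–L43] -/
theorem exists_eq_prod_X_sub_C_of_splits [IsDomain K] {f : K[X]} (hmonic : f.Monic) (hdeg : f.natDegree = b)
    (hsplit : f.Splits) :
    ∃ α : Fin b → K, f = ∏ i : Fin b, (Polynomial.X - Polynomial.C (α i)) := by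
  classical
  have hs := hsplit.eq_prod_roots_of_monic hmonic
  have hcard : f.roots.toList.length = b := by
    rw [Multiset.length_toList, ← hsplit.natDegree_eq_card_roots, hdeg]
  refine ⟨fun i => f.roots.toList.get (Fin.cast hcard.symm i), ?_⟩
  have hofFn : (List.ofFn fun i : Fin b => Polynomial.X - Polynomial.C (f.roots.toList.get (Fin.cast hcard.symm i))) =
      f.roots.toList.map (fun x => Polynomial.X - Polynomial.C x) := by
    rw [← List.ofFn_congr hcard (fun i => Polynomial.X - Polynomial.C (f.roots.toList.get i)),
      List.ofFn_comp' f.roots.toList.get (fun x => Polynomial.X - Polynomial.C x), List.ofFn_get]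
  conv_lhs => rw [hs]
  rw [← List.prod_ofFn, hofFn, ← Multiset.prod_coe, ← Multiset.map_coe, Multiset.coe_toList]

/-- **Thm. 1.16 (i), direction ⟹ (with the `H_{F_b}`-generators)** [Villamayor 2007, Thm. 1.16 (i) p0009 L55–L64
«`V(⟨G_{b,1}(a),…,G_{b,r_b}(a)⟩)` is the set of points in `Spec(R)` where the finite morphism is purely ramified»,
proof p0009 L80–L96]: for a `k`-algebra map `φ : S → K` to a domain over which `φ(f)`, `f = monicOf a`, splits
(e.g. `K` an algebraic closure of `k(P)`, Def. 1.1), if `φ` kills every `I^{(2)}_r(f)`, `r ≥ 1`, then `φ(f) = (Z − α)^b`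
— «the class of `f(Z)` … has a unique root». [cite: Villamayor2007, Thm. 1.16 (i) p0009 L55–L96] -/
theorem exists_map_eq_X_sub_C_pow_of_hElimIdeal_le_ker [IsDomain K] (φ : S →ₐ[k] K) (a : Fin b → S)
    (hsplit : ((monicOf a).map (φ : S →+* K)).Splits)
    (hker : ∀ r : ℕ, 1 ≤ r → hElimIdeal k a r ≤ RingHom.ker (φ : S →+* K)) :
    ∃ α : K, (monicOf a).map (φ : S →+* K) = (Polynomial.X - Polynomial.C α) ^ b := by
  rw [monicOf_map φ a] at hsplit ⊢
  have hH : ∀ r : ℕ, 1 ≤ r → hElimIdeal k (⇑φ ∘ a) r = ⊥ := by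
    intro r hr
    rw [hElimIdeal_map, Ideal.map_eq_bot_iff_le_ker]
    exact hker r hr
  obtain ⟨α, hα⟩ := exists_eq_prod_X_sub_C_of_splits (monicOf_monic _) (natDegree_monicOf _) hsplit
  rcases Nat.eq_zero_or_pos b with hb | hb
  · subst hb
    refine ⟨0, ?_⟩
    rw [hα, pow_zero]
    exact Finset.prod_of_isEmpty _
  · exact ⟨α ⟨0, hb⟩, eq_X_sub_C_pow_of_hElimIdeal_eq_bot k (⇑φ ∘ a) α hα hH ⟨0, hb⟩⟩

/-- **Thm. 1.16 (i) ⟹ with the full elimination ideals**: if `φ` kills every `I_r(f)`, `r ≥ 1`, and `φ(f)` splits in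
the domain `K`, then `φ(f) = (Z − α)^b`. [cite: Villamayor2007, Thm. 1.16 (i) p0009 L55–L96] -/
theorem exists_map_eq_X_sub_C_pow_of_elimIdeal_le_ker [IsDomain K] (φ : S →ₐ[k] K) (a : Fin b → S)
    (hsplit : ((monicOf a).map (φ : S →+* K)).Splits)
    (hker : ∀ r : ℕ, 1 ≤ r → elimIdeal k a r ≤ RingHom.ker (φ : S →+* K)) :
    ∃ α : K, (monicOf a).map (φ : S →+* K) = (Polynomial.X - Polynomial.C α) ^ b :=
  exists_map_eq_X_sub_C_pow_of_hElimIdeal_le_ker k φ a hsplit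
    fun r hr => (hElimIdeal_le_elimIdeal a r).trans (hker r hr)

/-- **Thm. 1.16 (i) at a split point, both directions** [Villamayor 2007, Thm. 1.16 (i) p0009 L55–L64]: for
`φ : S → K` into a domain over which `φ(f)` splits, `φ(f)` is a pure `b`-th power («purely ramified», Def. 1.1) iff
`I_r(f) ⊆ ker φ` for every `r ≥ 1` (⟸ here; ⟹ is `elimIdeal_le_ker_of_map_eq_pow` of `DegreePreserving.lean`).
[cite: Villamayor2007, Thm. 1.16 (i) p0009 L55–L64] -/
theorem map_eq_X_sub_C_pow_iff_elimIdeal_le_ker [IsDomain K] (φ : S →ₐ[k] K) (a : Fin b → S)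
    (hsplit : ((monicOf a).map (φ : S →+* K)).Splits) :
    (∃ α : K, (monicOf a).map (φ : S →+* K) = (Polynomial.X - Polynomial.C α) ^ b) ↔
      ∀ r : ℕ, 1 ≤ r → elimIdeal k a r ≤ RingHom.ker (φ : S →+* K) := by
  constructor
  · rintro ⟨α, hα⟩ r hr
    exact elimIdeal_le_ker_of_map_eq_pow φ a α hα hr
  · exact exists_map_eq_X_sub_C_pow_of_elimIdeal_le_ker k φ a hsplit

end Point

end Literature.AlgebraicGeometry.Villamayor2007

end
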